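import Summits.NavierStokesRegularity.FluidComputer.ClayBlowupSingularPoint
import HarnessLib

/-!
# Far-field regularity and singular points for DESIGNED blow-ups; the two E–C types round-trip

Cell `ns-blowup`, seat `ns-blowup-ecbridge-2` (g6; the E–C endpoint theory seat). LABEL: E–C typing
(KERNEL — no named fact). WHAT THIS IS NOT: not Navier–Stokes evidence — statements about TYPES nobody
has inhabited; nothing is constructed; no instance is claimed. Companion memo:
`run/shared/lean/pub/ns-blowup/ecbridge2/ECBRIDGE-2-MEMO-5.md`.

## Content (by-name consequences of `ClayBlowupFarField.lean` / `ClayBlowupSingularPoint.lean` for the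
construction lanes, which certify `DesignedBlowup ν`)

* `ClayBlowup.exists_farField_bound_Ico` — the far-field bound on the WHOLE lifespan `[0, T)` (early
  times by the sub-slab bound `exists_norm_le`);
* `DesignedBlowup.exists_farField_bound`, `DesignedBlowup.exists_singularPoint`,
  `DesignedBlowup.isCompact_singularSlice`, `DesignedBlowup.exists_unboundedOn_closedBall` — the g6 rows
  transported along `DesignedBlowup.toClayBlowup` (whose velocity, lifespan and force are those of the
  design, by `rfl`);
* `ClayBlowup.toClayBlowup_toDesignedBlowup`, `DesignedBlowup.toDesignedBlowup_toClayBlowup` — the two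
  bridges are mutually inverse (structure eta): at every `ν > 0` the E–C types `ClayBlowup ν` and
  `DesignedBlowup ν` are in canonical bijection.

References: C. L. Fefferman, Clay problem description, (C) [cite: FeffermanClay2006, (C)];
P. G. Lemarié-Rieusset (2016), Thm. 14.4 and proof of Thm. 14.5 [cite: LemarieRieusset2016, Thm. 14.4];
L. Escauriaza, G. Seregin, V. Šverák, Russ. Math. Surveys 58 (2003) §3 [cite: EscauriazaSereginSverak2003, §3].
-/

noncomputable section

namespace Summit.NavierStokesRegularity.FluidComputer

open Set MeasureTheory Filter Topology Function TopologicalSpace Metric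
open scoped ENNReal ContDiff NNReal
open Literature.Analysis.FluidPDE
open Summit.NavierStokesRegularity.NavierStokesRegularity
open Summit.NavierStokesRegularity.FluidComputer.PalasekTowerClayBridge

namespace ClayBlowup

variable {ν : ℝ} (X : ClayBlowup ν)

/-- **Far-field bound on the whole lifespan**: for a Clay blow-up at `ν > 0` there are `R`, `M` with
`‖u(t, x)‖ ≤ M` for all `0 ≤ t < T` and `|x| > R` (`exists_farField_bound` on `(T/2, T)`, the sub-slab
bound `exists_norm_le` on `[0, T/2]`). No named fact.
[cite: LemarieRieusset2016, Thm. 14.4 (p. 505) with the proof of Thm. 14.5 (p. 512)] -/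
theorem exists_farField_bound_Ico (hν : 0 < ν) :
    ∃ R M : ℝ, ∀ t ∈ Ico 0 X.T, ∀ x : EuclideanSpace ℝ (Fin 3), R < ‖x‖ → ‖X.u t x‖ ≤ M := by
  obtain ⟨R, M, h⟩ := X.exists_farField_bound hν
  obtain ⟨B, hB⟩ := X.exists_norm_le hν (show X.T / 2 < X.T by linarith [X.T_pos])
  refine ⟨R, max M B, fun t ht x hx => ?_⟩
  rcases le_or_gt t (X.T / 2) with hle | hgt
  · exact (hB t ⟨ht.1, hle⟩ x).trans (le_max_right _ _)
  · exact (h t ⟨hgt, ht.2⟩ x hx).trans (le_max_left _ _)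

/-- **Round trip**: the Clay blow-up of the designed blow-up of a Clay blow-up is the Clay blow-up
itself (structure eta). [folklore] -/
theorem toClayBlowup_toDesignedBlowup (hν : 0 < ν) : (X.toDesignedBlowup hν).toClayBlowup = X := by
  cases X
  rfl

end ClayBlowup

namespace DesignedBlowup

variable {ν : ℝ} (D : DesignedBlowup ν)

/-- **Round trip**: the designed blow-up of the Clay blow-up of a designed blow-up is the designed
blow-up itself (structure eta). [folklore] -/
theorem toDesignedBlowup_toClayBlowup (hν : 0 < ν) : D.toClayBlowup.toDesignedBlowup hν = D := by
  cases D
  rfl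

/-- **FAR-FIELD REGULARITY OF A DESIGNED BLOW-UP** (`ν > 0`): there are `R`, `M` with `‖u(t, x)‖ ≤ M`
for all `0 ≤ t < T`, `|x| > R` — the singularity the design produces cannot sit at spatial infinity.
No named fact. [cite: LemarieRieusset2016, Thm. 14.4 (p. 505) with the proof of Thm. 14.5 (p. 512)] -/
theorem exists_farField_bound (hν : 0 < ν) :
    ∃ R M : ℝ, ∀ t ∈ Ico 0 D.T, ∀ x : EuclideanSpace ℝ (Fin 3), R < ‖x‖ → ‖D.u t x‖ ≤ M :=
  D.toClayBlowup.exists_farField_bound_Ico hν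

/-- **A designed blow-up is unbounded on a compact ball** (`ν > 0`). [cite: LemarieRieusset2016, Thm. 11.2] -/
theorem exists_unboundedOn_closedBall (hν : 0 < ν) :
    ∃ R : ℝ, ∀ M' : ℝ, ∃ t ∈ Ico 0 D.T, ∃ x ∈ closedBall (0 : EuclideanSpace ℝ (Fin 3)) R,
      M' < ‖D.u t x‖ :=
  D.toClayBlowup.exists_unboundedOn_closedBall hν

/-- **A DESIGNED BLOW-UP HAS A SINGULAR POINT ON ITS FINAL SLICE, INSIDE A FIXED BALL** (`ν > 0`):
some `R` such that every `x₀` with `|x₀| > R` is backward bounded at time `T` and some `x₀` with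
`|x₀| ≤ R` is not (`IsBackwardBoundedAt`). No named fact. [cite: EscauriazaSereginSverak2003, §3] -/
theorem exists_singularPoint (hν : 0 < ν) :
    ∃ R : ℝ, (∀ x₀ : EuclideanSpace ℝ (Fin 3), R < ‖x₀‖ → IsBackwardBoundedAt D.u D.T x₀) ∧
      ∃ x₀ : EuclideanSpace ℝ (Fin 3), ‖x₀‖ ≤ R ∧ ¬ IsBackwardBoundedAt D.u D.T x₀ :=
  D.toClayBlowup.exists_singularPoint hν

/-- **The singular slice of a designed blow-up is a nonempty compact set** (`ν > 0`).
[cite: EscauriazaSereginSverak2003, §3] -/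
theorem isCompact_singularSlice (hν : 0 < ν) :
    IsCompact {x₀ : EuclideanSpace ℝ (Fin 3) | ¬ IsBackwardBoundedAt D.u D.T x₀} ∧
      {x₀ : EuclideanSpace ℝ (Fin 3) | ¬ IsBackwardBoundedAt D.u D.T x₀}.Nonempty :=
  D.toClayBlowup.isCompact_singularSlice hν

end DesignedBlowup

end Summit.NavierStokesRegularity.FluidComputer

end
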